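import Summits.ResolutionOfSingularities.ResolutionOfSingularities.Theorems.PurelyInseparableDim4ResConeCInfSharpEntryToolsPrime
import Summits.ResolutionOfSingularities.ResolutionOfSingularities.Theorems.PurelyInseparableDim4ResConeCInfSharpChainPrime
import Summits.ResolutionOfSingularities.ResolutionOfSingularities.Theorems.PurelyInseparableDim4SwapTransportTranslatedChainPrime
import Summits.ResolutionOfSingularities.ResolutionOfSingularities.Theorems.PurelyInseparableDim4ResConeCInfVirtualEntrySharpPrime
import HarnessLib
import HarnessLib.Audit.Tags

/-!
# Purely inseparable four-folds — THE ♯-ENTRY OF THE FLAGLESS BRANCH, every prime (E5♯): a light-pair chain whose framed children carry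
# NO u-row flag enters res-dim4-typ-1 g6's ♯-window (cell `res-dim4-pi`, K2(p) lane, rung-1 POWER-CONE LINE «light pair of TAIL(p, p−1, 3)»,
# flagless branch, FILE ♯8 / E5♯)

[OURS · counted 0 · cell `res-dim4-pi` · K2(p) lane (holder res-dim4-p-12 g5); seat res-dim4-p-3 g6 (MEMO `res-dim4-p-3/MEMO-g6-FLAGLESS-SHARP.md`
§§2–6).]  Nothing here proves K2(p) for any `p`, any TAIL(p, p−1, 3), `NoIsolatedTrap p p`, the Cossart–Jannsen–Saito theorem or resolution of
singularities in dimension ≥ 4 / characteristic `p` — NOT proved.  AI kernel work, weaker than expert review.  A CHAIN-LEVEL ASSEMBLY about OUR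
frame: it produces the entry hypothesis `hE♯` (row `ef = 0`) of res-dim4-typ-1 g6's `SwapTransport.cInf_no_chain_of_entry_sharp_prime` from the
NEGATION of the ledger-labelled per-chain Q-flag; the contradiction itself is that theorem's.

* §1 **`virtual_data_ext`** — W5a's recursion formulas determine `(πs, ℓs)` from `πs 0` (so the virtual labelling at the entry time does not
  depend on the precision); **`exists_letters_frequently`** — the letters-and-labelling pigeonhole (♯8-tools §3, curried).
* §2 **`cInf_hE_sharp_of_chain_prime_of_not_chainFlag_r`** (`d + 1 = p`, `4 ≤ d ≤ 6`).  HYPOTHESES: a light-pair chain in regime (isolated Step0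
  chain witnessed by `(j, b)`, `x^r ∣ F` at `0`, floor, shade `d`, `e_G = 3`, two weight-one letters from `k₀`) and, at a time `k′ ≥ k₀`, for
  cofinally many precisions `M` the data of a framed child `C₁ = step p univ κ 0 S₂` related to `c (k′+1)` along a labelling `π₀` NAMING THE
  LEDGER (`(c (k′+1)).r = π₀λ + π₀μ`) whose u-row flags `coeff x^r x_λx_μx_u^{eu+1}x_f^{ef}` (`eu + ef = d − 2`) ALL VANISH — literally the
  negation of `hQc_r` of `cInf_no_chain_prime_of_chainFlag_r`.  CONCLUSION: `hE♯` at row `0` — cofinal entry times `k` with letters, labelling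
  and, for every `(M, N)`, a virtual state related to `c k` at precision `M` carrying the 13-conjunct ♯-frame.
  ROUTE: pigeonhole on `(λ, μ, u, f, π₀)` (§1); ♯8-tools (`rel_comp_tsch`, `framed_child_frame_prime`) turn the data into the inputs of (I♭)
  `SwapTransport.exists_virtual_translated_chain_prime`; two SATELLITES `k + t₀ ≥ k₂`, `k + t₁ ≥ k + t₀ + 4` (free-tail lemma) are virtual letter
  changes ((ℓ-sat) `SwapTransport.virtual_letter_change_of_satellite_of_regime`); ♯8-chain `sharp_chain_prime` gives regime R, LAYER, the exact
  ledger and — the child being isolated, `d ≤ 6` — the ♯-flag `g ≠ 0` at `tₑ = t₀ + 3`; E4♯ `exists_cInf_virtual_entry_of_rel_sharp_prime` (with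
  `Φ = 0`: the translated child is already clean) hands over the ♯-frame at any jet `N`.
[cite: CossartJannsenSaito2020, Thm. 3.14, Lemma 13.2] [cite: Hauser2010, §§F–G]
bears_on: LADDER-RESOLUTION:D157-DOOR2 (res-dim4-pi · K2(p) · power cones · flagless branch E5♯).  Supports
stmt-ResolutionOfSingularities-16155 (helper).
-/

set_option linter.dupNamespace false -- mandated namespace of this single-conjunct summit

noncomputable section

namespace Summit.ResolutionOfSingularities.ResolutionOfSingularities.Theorems.PIDim4

namespace ResCone

open MvPolynomial Finset FrameChange
open Literature.AlgebraicGeometry.Resolution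
open Literature.AlgebraicGeometry.Resolution.CentreBlowup
open Literature.AlgebraicGeometry.Resolution.Hauser2010
open Literature.AlgebraicGeometry.Resolution.HauserPerlega2019

variable {K : Type} [Field K] [DecidableEq K]

/-! ## 1. Uniqueness of the recursion data; the letters pigeonhole -/

/-- **W5a's recursion formulas determine `(πs, ℓs)` from `πs 0`.** [OURS · bookkeeping] -/
theorem virtual_data_ext {la mu : Fin 4} {j : ℕ → Fin 4} {b : ℕ → Fin 4 → K} {k : ℕ}
    {πs πs' : ℕ → Equiv.Perm (Fin 4)} {ℓs ℓs' : ℕ → Fin 4}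
    (hℓs : ∀ t, ℓs t = if j (k + t) = πs t la then la else if j (k + t) = πs t mu then mu
      else if b (k + t) (πs t la) ≠ 0 then la else mu)
    (hπs : ∀ t, πs (t + 1) = if j (k + t) = πs t la ∨ j (k + t) = πs t mu then πs t
      else (Equiv.swap (ℓs t) ((πs t).symm (j (k + t)))).trans (πs t))
    (hℓs' : ∀ t, ℓs' t = if j (k + t) = πs' t la then la else if j (k + t) = πs' t mu then mu
      else if b (k + t) (πs' t la) ≠ 0 then la else mu)
    (hπs' : ∀ t, πs' (t + 1) = if j (k + t) = πs' t la ∨ j (k + t) = πs' t mu then πs' t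
      else (Equiv.swap (ℓs' t) ((πs' t).symm (j (k + t)))).trans (πs' t))
    (h0 : πs 0 = πs' 0) : πs = πs' ∧ ℓs = ℓs' := by
  have hℓ : ∀ t, πs t = πs' t → ℓs t = ℓs' t := fun t h => by rw [hℓs t, hℓs' t, h]
  have hπ : ∀ t, πs t = πs' t := by
    intro t
    induction t with
    | zero => exact h0
    | succ t ih => rw [hπs t, hπs' t, hℓ t ih, ih]
  exact ⟨funext hπ, funext fun t => hℓ t (hπ t)⟩

/-- **The letters-and-labelling pigeonhole** (♯8-tools `exists_forall_frequently_of_finite`, curried over `Fin 4⁴ × Perm (Fin 4)`).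
[folklore] -/
theorem exists_letters_frequently {Q : ℕ → Fin 4 → Fin 4 → Fin 4 → Fin 4 → Equiv.Perm (Fin 4) → Prop}
    (h : ∀ M₀ : ℕ, ∃ M, M₀ ≤ M ∧ ∃ (la mu u f : Fin 4) (π₀ : Equiv.Perm (Fin 4)), Q M la mu u f π₀) :
    ∃ (la mu u f : Fin 4) (π₀ : Equiv.Perm (Fin 4)), ∀ M₀ : ℕ, ∃ M, M₀ ≤ M ∧ Q M la mu u f π₀ := by
  obtain ⟨⟨la, mu, u, f, π₀⟩, hx⟩ := exists_forall_frequently_of_finite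
    (P := fun M (x : Fin 4 × Fin 4 × Fin 4 × Fin 4 × Equiv.Perm (Fin 4)) => Q M x.1 x.2.1 x.2.2.1 x.2.2.2.1 x.2.2.2.2)
    (fun M₀ => by
      obtain ⟨M, hM, la, mu, u, f, π₀, hQ⟩ := h M₀
      exact ⟨M, hM, ⟨la, mu, u, f, π₀⟩, hQ⟩)
  exact ⟨la, mu, u, f, π₀, hx⟩

/-! ## 2. The ♯-entry -/

/-- **THE ♯-ENTRY OF THE FLAGLESS BRANCH** (E5♯; module docstring §2): from the negation of the ledger-labelled per-chain Q-flag at a time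
`k′ ≥ k₀` to the ♯-window's entry `hE♯` at row `0`, for `d + 1 = p`, `4 ≤ d ≤ 6`. [OURS] [cite: CossartJannsenSaito2020, Thm. 3.14, Lemma 13.2]
[cite: Hauser2010, §§F–G] -/
theorem cInf_hE_sharp_of_chain_prime_of_not_chainFlag_r (p : ℕ) [hp : Fact p.Prime] [CharP K p] {d : ℕ} (hdp : d + 1 = p)
    (hd4 : 4 ≤ d) (hd6 : d ≤ 6) {c : ℕ → State K} {j : ℕ → Fin 4} {b : ℕ → Fin 4 → K}
    (hc : ∀ k, IsIsolated p (c k).F ∧ Step0 p (c k) (c (k + 1))) (hw : FreeTail.IsWitnessedChain p c j b)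
    (hr0 : ∀ e ∈ (c 0).F.support, (c 0).r ≤ e) (hfloor : ∀ k, ordZero (c k).F ≠ (p : ℕ)) {k₀ : ℕ}
    (hshade : ∀ k, k₀ ≤ k → (c k).shade = ((d : ℕ) : ℕ∞))
    (he3 : ∀ k, k₀ ≤ k → Module.finrank K (resVertex (c k)) = 3)
    (hwt : ∀ k, k₀ ≤ k → (∀ i, (c k).r i ≤ 1) ∧ (c k).r.degree = 2) {k' : ℕ} (hk' : k₀ ≤ k')
    (hnQ : ∀ M₀ : ℕ, ∃ M, M₀ ≤ M ∧ ∃ (la mu u f κ : Fin 4) (π₀ : Equiv.Perm (Fin 4)) (A₁ S₂ : State K)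
        (Φ : MvPolynomial (Fin 4) K) (θ' e' : Fin 4 → MvPolynomial (Fin 4) K) (U' E' : MvPolynomial (Fin 4) K) (a : K),
        la ≠ mu ∧ la ≠ u ∧ la ≠ f ∧ mu ≠ u ∧ mu ≠ f ∧ u ≠ f ∧ (κ = la ∨ κ = mu) ∧
        (c (k' + 1)).r = Finsupp.single (π₀ la) 1 + Finsupp.single (π₀ mu) 1 ∧
        θ' (π₀ la) = X la * e' la ∧ θ' (π₀ mu) = X mu * e' mu ∧ constantCoeff (e' la) ≠ 0 ∧ constantCoeff (e' mu) ≠ 0 ∧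
        constantCoeff (θ' (π₀ u)) = 0 ∧ constantCoeff (θ' (π₀ f)) = 0 ∧
        coeff (Finsupp.single u 1) (θ' (π₀ u)) * coeff (Finsupp.single f 1) (θ' (π₀ f)) -
          coeff (Finsupp.single f 1) (θ' (π₀ u)) * coeff (Finsupp.single u 1) (θ' (π₀ f)) ≠ 0 ∧
        constantCoeff U' ≠ 0 ∧ E' ∈ originIdeal K ^ M ∧ A₁.F = deletePthPowers p (U' ^ p * aeval θ' (c (k' + 1)).F) + E' ∧
        S₂.r = Finsupp.single la 1 + Finsupp.single mu 1 ∧ (∀ e ∈ S₂.F.support, S₂.r ≤ e) ∧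
        ordZero S₂.F = ((d + 2 : ℕ) : ℕ∞) ∧ a ≠ 0 ∧ resForm S₂ = C a * X f ^ d ∧
        (∀ e ∈ S₂.F.support, e f ≤ d - 1 → 2 ≤ e la ∧ 2 ≤ e mu) ∧
        f ∉ Φ.vars ∧ constantCoeff Φ = 0 ∧
        (CentreBlowup.step p Finset.univ κ 0 S₂).F = deletePthPowers p (tsch f Φ A₁.F) ∧
        ordZero (CentreBlowup.step p Finset.univ κ 0 S₂).F = ((d + 2 : ℕ) : ℕ∞) ∧
        IsIsolated p (CentreBlowup.step p Finset.univ κ 0 S₂).F ∧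
        Module.finrank K (resVertex (CentreBlowup.step p Finset.univ κ 0 S₂)) = 3 ∧
        ∀ eu ef : ℕ, eu + ef = d - 2 →
          coeff ((CentreBlowup.step p Finset.univ κ 0 S₂).r +
            (Finsupp.single la 1 + Finsupp.single mu 1 + Finsupp.single u (eu + 1) + Finsupp.single f ef))
            (CentreBlowup.step p Finset.univ κ 0 S₂).F = 0) :
    ∀ k₂, ∃ k, k₂ ≤ k ∧ ∃ (la mu u f : Fin 4) (π₀ : Equiv.Perm (Fin 4)),
      la ≠ mu ∧ la ≠ u ∧ la ≠ f ∧ mu ≠ u ∧ mu ≠ f ∧ u ≠ f ∧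
      (c k).r = Finsupp.single (π₀ la) 1 + Finsupp.single (π₀ mu) 1 ∧
      ∀ M N : ℕ, ∃ B₀ : State K,
        (∃ (θ e : Fin 4 → MvPolynomial (Fin 4) K) (U E : MvPolynomial (Fin 4) K),
          θ (π₀ la) = X la * e la ∧ θ (π₀ mu) = X mu * e mu ∧ constantCoeff (e la) ≠ 0 ∧ constantCoeff (e mu) ≠ 0 ∧
          constantCoeff (θ (π₀ u)) = 0 ∧ constantCoeff (θ (π₀ f)) = 0 ∧
          coeff (Finsupp.single u 1) (θ (π₀ u)) * coeff (Finsupp.single f 1) (θ (π₀ f)) -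
            coeff (Finsupp.single f 1) (θ (π₀ u)) * coeff (Finsupp.single u 1) (θ (π₀ f)) ≠ 0 ∧
          constantCoeff U ≠ 0 ∧ E ∈ originIdeal K ^ M ∧ B₀.F = deletePthPowers p (U ^ p * aeval θ (c k).F) + E) ∧
        ordZero B₀.F = ((d + 2 : ℕ) : ℕ∞) ∧ B₀.r = Finsupp.single la 1 + Finsupp.single mu 1 ∧
          (∀ e ∈ B₀.F.support, B₀.r ≤ e) ∧ (∃ a : K, a ≠ 0 ∧ resForm B₀ = C a * X f ^ d) ∧
          (∀ e ∈ B₀.F.support, e.degree = d + 2 →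
            e = Finsupp.single la 1 + Finsupp.single mu 1 + Finsupp.single u 0 + Finsupp.single f d) ∧
          (∀ e ∈ B₀.F.support, e f ≤ d - 1 → 2 ≤ e la ∧ 2 ≤ e mu) ∧
          (∀ e ∈ B₀.F.support, e f + 2 ≤ d → 3 ≤ e la) ∧ (∀ e ∈ B₀.F.support, e f + 2 ≤ d → 3 ≤ e mu) ∧
          (∀ E : Fin 4 →₀ ℕ, E.degree = d + 3 → E f + 2 ≤ d → coeff E B₀.F = 0) ∧
          (∀ e ∈ B₀.F.support, e.degree < N → ¬ (e u = d - 3 - 0 ∧ e f = 0)) ∧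
          coeff (Finsupp.single la 3 + Finsupp.single mu 3 + Finsupp.single u (d - 2 - 0) + Finsupp.single f 0) B₀.F ≠ 0 ∧
          IsIsolated p B₀.F ∧ Module.finrank K (resVertex B₀) = 3 := by
  intro k₂
  classical
  have hd2 : 2 ≤ d := by omega
  have hdp2 : d + 2 = p + 1 := by omega
  -- the real chain in regime
  have hiso : ∀ k, IsIsolated p (c k).F := fun k => (hc k).1
  have ho6 : ∀ m, k₀ ≤ m → ordZero (c m).F = ((d + 2 : ℕ) : ℕ∞) := fun m hm => by
    obtain ⟨o, ho, -, -, hod⟩ := chain_shade_nat p hc hfloor hshade hm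
    rw [(hwt m hm).2] at hod
    have h6 : o = d + 2 := by omega
    rw [ho, h6]
  have hdiv : ∀ m, ∀ e ∈ (c m).F.support, (c m).r ≤ e := IsolatedBand.isolated_chain_forall_le hc hr0
  have hcs : ∀ m, c (m + 1) = CentreBlowup.step p Finset.univ (j m) (b m) (c m) := fun m => (hw m).2.2.2.2
  set k : ℕ := k' + 1 with hk
  -- 1. the data, reshaped: for cofinally many precisions a FLAGLESS framed state related to `c k` along a labelling naming the ledger
  have hgood : ∀ M₀ : ℕ, ∃ M, M₀ ≤ M ∧ ∃ (la mu u f : Fin 4) (π₀ : Equiv.Perm (Fin 4)),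
      la ≠ mu ∧ la ≠ u ∧ la ≠ f ∧ mu ≠ u ∧ mu ≠ f ∧ u ≠ f ∧
      (c k).r = Finsupp.single (π₀ la) 1 + Finsupp.single (π₀ mu) 1 ∧
      ∃ B₀ : State K, (∃ (θ e : Fin 4 → MvPolynomial (Fin 4) K) (U E : MvPolynomial (Fin 4) K),
          θ (π₀ la) = X la * e la ∧ θ (π₀ mu) = X mu * e mu ∧ constantCoeff (e la) ≠ 0 ∧ constantCoeff (e mu) ≠ 0 ∧
          constantCoeff (θ (π₀ u)) = 0 ∧ constantCoeff (θ (π₀ f)) = 0 ∧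
          coeff (Finsupp.single u 1) (θ (π₀ u)) * coeff (Finsupp.single f 1) (θ (π₀ f)) -
            coeff (Finsupp.single f 1) (θ (π₀ u)) * coeff (Finsupp.single u 1) (θ (π₀ f)) ≠ 0 ∧
          constantCoeff U ≠ 0 ∧ E ∈ originIdeal K ^ M ∧ B₀.F = deletePthPowers p (U ^ p * aeval θ (c k).F) + E) ∧
        (ordZero B₀.F = ((d + 2 : ℕ) : ℕ∞) ∧ B₀.r = Finsupp.single la 1 + Finsupp.single mu 1 ∧
          (∀ e ∈ B₀.F.support, B₀.r ≤ e) ∧ (∃ a : K, a ≠ 0 ∧ resForm B₀ = C a * X f ^ d) ∧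
          (∀ e ∈ B₀.F.support, e.degree = d + 2 →
            e = Finsupp.single la 1 + Finsupp.single mu 1 + Finsupp.single u 0 + Finsupp.single f d) ∧
          (∀ e ∈ B₀.F.support, e f ≤ d - 1 → 2 ≤ e la ∧ 2 ≤ e mu) ∧
          IsIsolated p B₀.F ∧ Module.finrank K (resVertex B₀) = 3) ∧
        (∀ c' : ℕ, c' + 2 ≤ d →
          coeff (Finsupp.single la 2 + Finsupp.single mu 2 + Finsupp.single u (d - 1 - c') + Finsupp.single f c') B₀.F = 0) := by
    intro M₀
    obtain ⟨M, hM, la, mu, u, f, κ, π₀, A₁, S₂, Φ, θ', e', U', E', a, hlm, hlu, hlf, hmu, hmf, huf, hκ, hrA, h1, h2, h3, h4, h5,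
      h6, h7, h8, h9, h10, hrS, hdivS, hoS, ha, hresS, hledS, hΦv, hΦ0, hC₁F, hoC, hisoC, he3C, hflagC⟩ := hnQ M₀
    obtain ⟨hrC, hdivC, hledC, ⟨a', ha', hresC⟩, hstrC⟩ :=
      framed_child_frame_prime hlm hlu hlf hmu hmf huf p hdp hd2 hκ hrS hdivS hoS hresS hledS hoC he3C
    refine ⟨M, hM, la, mu, u, f, π₀, hlm, hlu, hlf, hmu, hmf, huf, hrA, CentreBlowup.step p Finset.univ κ 0 S₂,
      rel_comp_tsch p hlm hlu hlf hmu hmf huf ⟨θ', e', U', E', h1, h2, h3, h4, h5, h6, h7, h8, h9, h10⟩ hΦv hΦ0 hC₁F,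
      ⟨hoC, hrC, hdivC, ⟨a', ha', hresC⟩, hstrC, hledC, hisoC, he3C⟩, fun c' hc' => ?_⟩
    have hexp : ((CentreBlowup.step p Finset.univ κ 0 S₂).r +
        (Finsupp.single la 1 + Finsupp.single mu 1 + Finsupp.single u (d - 2 - c' + 1) + Finsupp.single f c') : Fin 4 →₀ ℕ) =
        Finsupp.single la 2 + Finsupp.single mu 2 + Finsupp.single u (d - 1 - c') + Finsupp.single f c' := by
      rw [hrC]
      ext x
      simp only [Finsupp.coe_add, Pi.add_apply, Finsupp.single_apply]
      split_ifs <;> omega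
    have h := hflagC (d - 2 - c') c' (by omega)
    rwa [hexp] at h
  -- 2. fix the letters and the labelling
  obtain ⟨la, mu, u, f, π₀, hfreq⟩ := exists_letters_frequently hgood
  obtain ⟨-, -, hlm, hlu, hlf, hmu, hmf, huf, hrA0, -⟩ := hfreq 0
  -- 3. the recursion data (precision-independent)
  obtain ⟨πs, -, ℓs, hπ0, -, -, hℓs, hπs⟩ := SwapTransport.exists_virtual_data_prime p j b k la mu π₀ (c 0)
  have hℓ : ∀ t, ℓs t = la ∨ ℓs t = mu := SwapTransport.ℓs_eq_or hℓs
  -- 4. two satellites after `max k k₂`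
  obtain ⟨s₀, hks₀, hsat₀⟩ := (FreeTail.satelliteRecurrenceAt_iff_noIsolatedFreeTailAt p p).mpr
    (FreeTailProof.noIsolatedFreeTailAt_self p) K c j b hw hiso (max k k₂)
  obtain ⟨s₁, hks₁, hsat₁⟩ := (FreeTail.satelliteRecurrenceAt_iff_noIsolatedFreeTailAt p p).mpr
    (FreeTailProof.noIsolatedFreeTailAt_self p) K c j b hw hiso (s₀ + 4)
  obtain ⟨t₀, rfl⟩ : ∃ t₀, s₀ = k + t₀ := ⟨s₀ - k, by omega⟩
  obtain ⟨t₁, rfl⟩ : ∃ t₁, s₁ = k + t₁ := ⟨s₁ - k, by omega⟩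
  have h01 : t₀ < t₁ := by omega
  -- the chain length and the entry offset
  set T : ℕ := t₁ + 2 with hT
  -- a common certificate on `c k, …, c (k + T + 1)`
  obtain ⟨Nc, hcert⟩ := SwapTransport.exists_common_cert_prime p (k := k) (T := T + 1) (fun t _ => hiso (k + t))
  -- the unpinned virtual chain from a flagless framed state at precision `M'`
  have hchain : ∀ M' : ℕ, Nc + 2 * p + 2 + p * T ≤ M' → ∀ B₀ : State K,
      (∃ (θ e : Fin 4 → MvPolynomial (Fin 4) K) (U E : MvPolynomial (Fin 4) K),
          θ (π₀ la) = X la * e la ∧ θ (π₀ mu) = X mu * e mu ∧ constantCoeff (e la) ≠ 0 ∧ constantCoeff (e mu) ≠ 0 ∧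
          constantCoeff (θ (π₀ u)) = 0 ∧ constantCoeff (θ (π₀ f)) = 0 ∧
          coeff (Finsupp.single u 1) (θ (π₀ u)) * coeff (Finsupp.single f 1) (θ (π₀ f)) -
            coeff (Finsupp.single f 1) (θ (π₀ u)) * coeff (Finsupp.single u 1) (θ (π₀ f)) ≠ 0 ∧
          constantCoeff U ≠ 0 ∧ E ∈ originIdeal K ^ M' ∧ B₀.F = deletePthPowers p (U ^ p * aeval θ (c k).F) + E) →
      (ordZero B₀.F = ((d + 2 : ℕ) : ℕ∞) ∧ B₀.r = Finsupp.single la 1 + Finsupp.single mu 1 ∧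
          (∀ e ∈ B₀.F.support, B₀.r ≤ e) ∧ (∃ a : K, a ≠ 0 ∧ resForm B₀ = C a * X f ^ d) ∧
          (∀ e ∈ B₀.F.support, e.degree = d + 2 →
            e = Finsupp.single la 1 + Finsupp.single mu 1 + Finsupp.single u 0 + Finsupp.single f d) ∧
          (∀ e ∈ B₀.F.support, e f ≤ d - 1 → 2 ≤ e la ∧ 2 ≤ e mu) ∧
          IsIsolated p B₀.F ∧ Module.finrank K (resVertex B₀) = 3) →
      ∃ (Bs : ℕ → State K) (βs : ℕ → K), Bs 0 = B₀ ∧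
        (∀ t, t ≤ T → Bs (t + 1) =
          CentreBlowup.step p Finset.univ (ℓs t) (Function.update (0 : Fin 4 → K) u (βs t)) (Bs t)) ∧
        ∀ t, t ≤ T + 1 →
          (∃ (θ e : Fin 4 → MvPolynomial (Fin 4) K) (U E : MvPolynomial (Fin 4) K),
            θ (πs t la) = X la * e la ∧ θ (πs t mu) = X mu * e mu ∧ constantCoeff (e la) ≠ 0 ∧ constantCoeff (e mu) ≠ 0 ∧
            constantCoeff (θ (πs t u)) = 0 ∧ constantCoeff (θ (πs t f)) = 0 ∧
            coeff (Finsupp.single u 1) (θ (πs t u)) * coeff (Finsupp.single f 1) (θ (πs t f)) -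
              coeff (Finsupp.single f 1) (θ (πs t u)) * coeff (Finsupp.single u 1) (θ (πs t f)) ≠ 0 ∧
            constantCoeff U ≠ 0 ∧ E ∈ originIdeal K ^ (M' - p * t) ∧ (Bs t).F = deletePthPowers p (U ^ p * aeval θ (c (k + t)).F) + E) ∧
          (c (k + t)).r = Finsupp.single (πs t la) 1 + Finsupp.single (πs t mu) 1 ∧
          (ordZero (Bs t).F = ((d + 2 : ℕ) : ℕ∞) ∧ (Bs t).r = Finsupp.single la 1 + Finsupp.single mu 1 ∧
            (∀ e ∈ (Bs t).F.support, (Bs t).r ≤ e) ∧ (∃ a : K, a ≠ 0 ∧ resForm (Bs t) = C a * X f ^ d) ∧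
            (∀ e ∈ (Bs t).F.support, e.degree = d + 2 →
              e = Finsupp.single la 1 + Finsupp.single mu 1 + Finsupp.single u 0 + Finsupp.single f d) ∧
            (∀ e ∈ (Bs t).F.support, e f ≤ d - 1 → 2 ≤ e la ∧ 2 ≤ e mu) ∧
            IsIsolated p (Bs t).F ∧ Module.finrank K (resVertex (Bs t)) = 3) := by
    intro M' hM' B₀ hrel0 hfr0
    obtain ⟨πs', Bs, ℓs', βs, hπ0', hB0, hℓs', hπs', hstep, hpk⟩ :=
      SwapTransport.exists_virtual_translated_chain_prime p hdp hd2 hlm hlu hlf hmu hmf huf hw (k := k) (Nc := Nc) (T := T)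
        (fun t _ => hiso (k + t)) hcert (fun t _ => ho6 (k + t) (by omega)) (fun t _ => he3 (k + t) (by omega))
        (fun t _ => hwt (k + t) (by omega)) (fun t _ => hdiv (k + t)) hM' hrel0 hrA0 hfr0
    obtain ⟨rfl, rfl⟩ := virtual_data_ext hℓs' hπs' hℓs hπs (hπ0'.trans hπ0.symm)
    exact ⟨Bs, βs, hB0, hstep, hpk⟩
  -- the entry labelling `πs tₑ` (from one instance)
  obtain ⟨Ma, hMa, -, -, -, -, -, -, -, Ba, hrela, hfra, -⟩ := hfreq (Nc + 2 * p + 2 + p * T)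
  obtain ⟨Bsa, βsa, -, -, hpka⟩ := hchain Ma hMa Ba hrela hfra
  have hrAe : (c (k + (t₀ + 3))).r = Finsupp.single (πs (t₀ + 3) la) 1 + Finsupp.single (πs (t₀ + 3) mu) 1 :=
    (hpka (t₀ + 3) (by omega)).2.1
  refine ⟨k + (t₀ + 3), by omega, la, mu, u, f, πs (t₀ + 3), hlm, hlu, hlf, hmu, hmf, huf, hrAe, fun M N => ?_⟩
  -- 5. per precision: the virtual chain, the two letter changes, regime R + LAYER + the ♯-flag at `tₑ`, and E4♯
  obtain ⟨Mn, hMn, -, -, -, -, -, -, -, B₀, hrel0, hfr0, hflag0⟩ := hfreq (M + Nc + 2 * p + 2 + p * T)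
  obtain ⟨Bs, βs, hB0, hstep, hpk⟩ := hchain Mn (by omega) B₀ hrel0 hfr0
  -- letter changes at the two satellites
  have hchange : ∀ t, t + 1 ≤ T → FreeTail.IsSatellite j b (k + t) → ℓs t ≠ ℓs (t + 1) := by
    intro t ht hsat
    have hcs' : c (k + (t + 2)) = CentreBlowup.step p Finset.univ (j (k + (t + 1))) (b (k + (t + 1))) (c (k + (t + 1))) := by
      rw [show k + (t + 2) = k + (t + 1) + 1 by omega]; exact hcs _
    have ho' : ordZero (c (k + (t + 1))).F = ((p + 1 : ℕ) : ℕ∞) := by rw [← hdp2]; exact ho6 _ (by omega)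
    exact (SwapTransport.virtual_letter_change_of_satellite_of_regime p hlm hlu hlf hmu hmf huf hℓs hπs
      (hpk (t + 1) (by omega)).2.1 ho' hcs' (hwt (k + (t + 2)) (by omega)).1 (hwt (k + (t + 2)) (by omega)).2 hsat).symm
  have hch₀ := hchange t₀ (by omega) hsat₀
  have hch₁ := hchange t₁ (by omega) hsat₁
  -- the chain theorem's inputs
  have hq : ∀ t, t ≤ T → ((p : ℕ) : ℕ∞) ≤ ordAlong Finset.univ (Bs t).F := fun t ht => by
    rw [ordAlong_univ, (hpk t (by omega)).2.2.1]; exact_mod_cast (by omega : p ≤ d + 2)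
  have hreg : ∀ t, t ≤ T → ∀ E ∈ (Bs t).F.support,
      d + 3 ≤ E.degree ∨ E = Finsupp.single la 1 + Finsupp.single mu 1 + Finsupp.single u 0 + Finsupp.single f d :=
    fun t ht => reg_of_straight (hpk t (by omega)).2.2.1 (hpk t (by omega)).2.2.2.2.2.2.1
  obtain ⟨-, hrB0, hdivB0, -, -, hledB0, -, -⟩ := hfr0
  have hr1₀ : ∀ e ∈ (Bs 0).F.support, 1 ≤ e la ∧ 1 ≤ e mu := by
    rw [hB0]
    intro e he
    have h := Finsupp.le_def.mp (hdivB0 e he)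
    have h1 := h la
    have h2 := h mu
    rw [hrB0, Finsupp.add_apply, Finsupp.single_eq_same, Finsupp.single_eq_of_ne hlm, add_zero] at h1
    rw [hrB0, Finsupp.add_apply, Finsupp.single_eq_of_ne hlm.symm, Finsupp.single_eq_same, zero_add] at h2
    exact ⟨h1, h2⟩
  have hled₀ : ∀ e ∈ (Bs 0).F.support, e f ≤ d - 1 → 2 ≤ e la ∧ 2 ≤ e mu := by rw [hB0]; exact hledB0
  have hflag₀ : (∀ c' : ℕ, c' + 2 ≤ d →
        coeff (Finsupp.single la 2 + Finsupp.single mu 2 + Finsupp.single u (d - 1 - c') + Finsupp.single f c') (Bs 0).F = 0) := by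
    rw [hB0]; exact hflag0
  obtain ⟨-, hlede, hRe, hlayere, hge⟩ := sharp_chain_prime hlm hlu hlf hmu hmf huf p hdp hd2 Bs ℓs βs
    (fun t ht => hstep t ht.le) hℓ hq hreg hr1₀ hled₀ hflag₀ h01 (by omega) hch₀ hch₁ (t₀ + 3) (by omega) (by omega)
  -- the package at the entry time
  obtain ⟨⟨θ', e', U', E', h1, h2, h3, h4, h5, h6, h7, h8, h9, h10⟩, -, hoe, hre, hdive, ⟨a, ha, hrese⟩, -, -, hisoe, he3e⟩ :=
    hpk (t₀ + 3) (by omega)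
  have hg := hge hd6 le_rfl hisoe
  -- the translated child is clean: `(Bs tₑ).F = clean (tsch f 0 (Bs tₑ).F)`
  have hclean : (Bs (t₀ + 3)).F = deletePthPowers p (tsch f (0 : MvPolynomial (Fin 4) K) (Bs (t₀ + 3)).F) := by
    rw [tsch_zero, AlgHom.id_apply, hstep (t₀ + 2) (by omega)]
    exact (PointBlowup.deletePthPowers_deletePthPowers p _).symm
  have hg' : coeff ((Bs (t₀ + 3)).r +
      (Finsupp.single la 2 + Finsupp.single mu 2 + Finsupp.single u (d - 2 - 0) + Finsupp.single f 0)) (Bs (t₀ + 3)).F ≠ 0 := by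
    have hexp : ((Bs (t₀ + 3)).r +
        (Finsupp.single la 2 + Finsupp.single mu 2 + Finsupp.single u (d - 2 - 0) + Finsupp.single f 0) : Fin 4 →₀ ℕ) =
        Finsupp.single la 3 + Finsupp.single mu 3 + Finsupp.single u (d - 2) + Finsupp.single f 0 := by
      rw [hre]
      ext x
      simp only [Finsupp.coe_add, Pi.add_apply, Finsupp.single_apply]
      split_ifs <;> omega
    rw [hexp]; exact hg
  obtain ⟨B₁, ⟨θ, e, U, E, g1, g2, g3, g4, g5, g6, g7, g8, g9, g10⟩, hfr⟩ :=
    exists_cInf_virtual_entry_of_rel_sharp_prime p hdp (c := 0) (by omega) hlm hlu hlf hmu hmf huf h1 h2 h3 h4 h5 h6 h7 h8 h9 h10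
      (Φ := 0) (by simp) (map_zero _) hclean hoe hre hdive ha hrese hlede hRe hlayere hisoe he3e hg' N
  have hpt : p * (t₀ + 3) ≤ p * T := Nat.mul_le_mul_left p (by omega)
  exact ⟨B₁, ⟨θ, e, U, E, g1, g2, g3, g4, g5, g6, g7, g8, Ideal.pow_le_pow_right (by omega) g9, g10⟩, hfr⟩

end ResCone

end Summit.ResolutionOfSingularities.ResolutionOfSingularities.Theorems.PIDim4
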